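import Summits.Ventures.YMGap.Thresholds.OneLinkEigenModulus
import Summits.Ventures.YMGap.Thresholds.StarMassGapSUN
import HarnessLib

/-!
# Venture YMGap — the one-link eigen modulus through the star door: `MassGapAt 4 N x` for every `SU(N)`,
# `N ≥ 6`, at every 't Hooft `|x| ≤ 1/32` (and `|x| ≤ 4/127` for `N ≥ 10`), hypothesis-free, by the DS route

HONEST FRAMING: venture file of the cell `pub-ymgap` (QuantumFields programme), strong-coupling LATTICE statements for
`SU(N)` lattice Yang–Mills on `ℤ⁴` (Wilson action, tree coupling `N·x`, 't Hooft `x`); nothing about the continuum or the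
Clay mass gap; no decay rate beyond `∃ c > 0`.  WHAT: the generic-`N` star door of track (c)
(`StarSUNLimit.star_massGapAt_of_oneLinkKRModulus`: a one-link modulus `K` on the ball `R ≥ 6|x|` with `4K|x| ≤ 9/25` gives
`MassGapAt 4 N x`) fed with the first-order eigen modulus `K₁(N,R) = (N²/(N²−1))·(1/2 + 2R)/(1/2 − R)` of
`OneLinkEigenModulus` instead of the Bakry–Émery `1/(1/2 − R)`.  OUTPUT (all hypothesis-free, kernel-checked):

* `massGapAt_SU_eigen` / `improvedThreshold_SU_eigen`: for EVERY `N ≥ 6`, `MassGapAt 4 N x` at every `|x| ≤ 1/32` and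
  `ImprovedThreshold 4 N (1/32)` — numerically the SAME window as the cell's sharp Bakry–Émery threshold `1/(8d) = 1/32`
  (`HessianSharp.improvedThreshold_sharp`, conditional on printed facts; OBJECT U removes them), reached here by a
  DISJOINT method (Dobrushin–Shlosman star windows + one-link analysis, no global Hessian, no Poisson road) — a second,
  method-independent kernel leg for the all-`N` `1/32` row when `N ≥ 6`.  (At `N = 6`, `x = 1/32` the door inequality
  `4K₁|x| ≤ 9/25` holds with EQUALITY.)
* `massGapAt_SU_eigen_ten` / `improvedThreshold_SU_eigen_ten`: for every `N ≥ 10`, the window `|x| ≤ 4/127 = 0.03149…`,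
  strictly beyond `1/32 = 0.03125` (by `0.8 %`; the supremum of the method is `0.0317` as `N → ∞`): the first all-large-`N`
  row of the cell beyond the sharp Bakry–Émery window.  A SENTENCE, not a headline (cell note `HOME/p2/ONE-LINK-MODULUS.md`).

For `N ≤ 5` the Bakry–Émery modulus is better at the relevant radius and the rows of `StarMassGapSUN` (`9/308`, every
`N ≥ 2`) / `ImprovedThresholdStar` (`SU(2)`, `9/100`) stand.
-/

noncomputable section

open Literature.MathematicalPhysics.QuantumFieldTheory
open Literature.MathematicalPhysics.QuantumFieldTheory.Balaban1983to89.StrongCouplingDobrushinWindow (OneLinkKRModulus)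
open Summit.Ventures.YMGap.StarSUNLimit (star_massGapAt_of_oneLinkKRModulus)
open Summit.Ventures.YMGap.OneLinkEigen

namespace Summit.Ventures.YMGap.OneLinkEigenRows

variable {N : ℕ}

/-- `N²/(N²−1) ≤ N₀²/(N₀²−1)` for `N ≥ N₀ ≥ 2` (the Casimir factor decreases in `N`). [folklore] -/
theorem casimirFactor_le {N₀ N : ℕ} (hN₀ : 2 ≤ N₀) (hN : N₀ ≤ N) :
    (N : ℝ) ^ 2 / ((N : ℝ) ^ 2 - 1) ≤ (N₀ : ℝ) ^ 2 / ((N₀ : ℝ) ^ 2 - 1) := by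
  have h0 : (2 : ℝ) ≤ N₀ := by exact_mod_cast hN₀
  have h1 : (N₀ : ℝ) ≤ N := by exact_mod_cast hN
  have hp0 : (0 : ℝ) < (N₀ : ℝ) ^ 2 - 1 := by nlinarith
  have hp : (0 : ℝ) < (N : ℝ) ^ 2 - 1 := by nlinarith
  rw [div_le_div_iff₀ hp hp0]
  nlinarith [mul_le_mul h1 h1 (by linarith) (by linarith)]

/-- **The door inequality for `N ≥ 6`, `|x| ≤ 1/32`**: `4 · K₁(N, 6|x|) · |x| ≤ 9/25` (equality at `N = 6`, `|x| = 1/32`).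
[folklore] -/
theorem door_le_six (hN : 6 ≤ N) {a : ℝ} (ha0 : 0 ≤ a) (ha : a ≤ 1 / 32) :
    4 * ((N : ℝ) ^ 2 / ((N : ℝ) ^ 2 - 1) * ((1 / 2 + 2 * (6 * a)) / (1 / 2 - 6 * a)) * a) ≤ 9 / 25 := by
  have hC : (N : ℝ) ^ 2 / ((N : ℝ) ^ 2 - 1) ≤ 36 / 35 := by
    have := casimirFactor_le (N₀ := 6) (by norm_num) hN; norm_num at this; exact this
  have hE : (1 / 2 + 2 * (6 * a)) / (1 / 2 - 6 * a) ≤ 14 / 5 := by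
    rw [div_le_div_iff₀ (by linarith) (by norm_num)]; linarith
  have hE0 : 0 ≤ (1 / 2 + 2 * (6 * a)) / (1 / 2 - 6 * a) := div_nonneg (by linarith) (by linarith)
  have hC0 : 0 ≤ (N : ℝ) ^ 2 / ((N : ℝ) ^ 2 - 1) := by
    have h6 : (6 : ℝ) ≤ N := by exact_mod_cast hN
    exact div_nonneg (by positivity) (by nlinarith)
  calc 4 * ((N : ℝ) ^ 2 / ((N : ℝ) ^ 2 - 1) * ((1 / 2 + 2 * (6 * a)) / (1 / 2 - 6 * a)) * a)
      ≤ 4 * ((36 / 35) * (14 / 5) * (1 / 32)) := by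
        refine mul_le_mul_of_nonneg_left ?_ (by norm_num)
        exact mul_le_mul (mul_le_mul hC hE hE0 (by norm_num)) ha ha0 (by positivity)
    _ = 9 / 25 := by norm_num

/-- **The door inequality for `N ≥ 10`, `|x| ≤ 4/127`**: `4 · K₁(N, 6|x|) · |x| ≤ 9/25`. [folklore] -/
theorem door_le_ten (hN : 10 ≤ N) {a : ℝ} (ha0 : 0 ≤ a) (ha : a ≤ 4 / 127) :
    4 * ((N : ℝ) ^ 2 / ((N : ℝ) ^ 2 - 1) * ((1 / 2 + 2 * (6 * a)) / (1 / 2 - 6 * a)) * a) ≤ 9 / 25 := by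
  have hC : (N : ℝ) ^ 2 / ((N : ℝ) ^ 2 - 1) ≤ 100 / 99 := by
    have := casimirFactor_le (N₀ := 10) (by norm_num) hN; norm_num at this; exact this
  have hE : (1 / 2 + 2 * (6 * a)) / (1 / 2 - 6 * a) ≤ 223 / 79 := by
    rw [div_le_div_iff₀ (by linarith) (by norm_num)]; linarith
  have hE0 : 0 ≤ (1 / 2 + 2 * (6 * a)) / (1 / 2 - 6 * a) := div_nonneg (by linarith) (by linarith)
  have hC0 : 0 ≤ (N : ℝ) ^ 2 / ((N : ℝ) ^ 2 - 1) := by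
    have h6 : (10 : ℝ) ≤ N := by exact_mod_cast hN
    exact div_nonneg (by positivity) (by nlinarith)
  calc 4 * ((N : ℝ) ^ 2 / ((N : ℝ) ^ 2 - 1) * ((1 / 2 + 2 * (6 * a)) / (1 / 2 - 6 * a)) * a)
      ≤ 4 * ((100 / 99) * (223 / 79) * (4 / 127)) := by
        refine mul_le_mul_of_nonneg_left ?_ (by norm_num)
        exact mul_le_mul (mul_le_mul hC hE hE0 (by norm_num)) ha ha0 (by positivity)
    _ ≤ 9 / 25 := by norm_num

/-- **`MassGapAt 4 N x` FOR EVERY `SU(N)`, `N ≥ 6`, AT EVERY 't Hooft `|x| ≤ 1/32`, HYPOTHESIS-FREE, BY THE DS ROUTE**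
(DLR uniqueness + the Shen–Zhu–Zhu covariance clause for every DLR state of the `ℤ⁴` specification at tree coupling
`N·x`): the generic star door with the eigen modulus `oneLinkKRModulus_eigen` on the ball `R = 6|x|`.  The same number as
the sharp Bakry–Émery window `1/(8d)`, `d = 4`, by a disjoint method. [folklore] -/
theorem massGapAt_SU_eigen (hN : 6 ≤ N) {x : ℝ} (h : |x| ≤ 1 / 32) : MassGapAt 4 N x := by
  have hx0 : 0 ≤ |x| := abs_nonneg x
  have hR : |x| * 6 < 1 / 2 := by linarith
  have hN2 : 2 ≤ N := by omega
  have hK0 : 0 ≤ (N : ℝ) ^ 2 / ((N : ℝ) ^ 2 - 1) * ((1 / 2 + 2 * (|x| * 6)) / (1 / 2 - |x| * 6)) := by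
    have h6 : (6 : ℝ) ≤ N := by exact_mod_cast hN
    exact mul_nonneg (div_nonneg (by positivity) (by nlinarith)) (div_nonneg (by linarith) (by linarith))
  refine star_massGapAt_of_oneLinkKRModulus (by omega) hK0 le_rfl (oneLinkKRModulus_eigen hN2 hR) ?_
  have := door_le_six hN hx0 h
  calc 4 * ((N : ℝ) ^ 2 / ((N : ℝ) ^ 2 - 1) * ((1 / 2 + 2 * (|x| * 6)) / (1 / 2 - |x| * 6)) * |x|)
      = 4 * ((N : ℝ) ^ 2 / ((N : ℝ) ^ 2 - 1) * ((1 / 2 + 2 * (6 * |x|)) / (1 / 2 - 6 * |x|)) * |x|) := by ring_nf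
    _ ≤ 9 / 25 := this

/-- **`MassGapBelow 4 N (1/32)` for every `N ≥ 6`, hypothesis-free, by the DS route.** [folklore] -/
theorem massGapBelow_SU_eigen (hN : 6 ≤ N) : MassGapBelow 4 N (1 / 32) :=
  fun _ hx => massGapAt_SU_eigen hN hx.le

/-- **`ImprovedThreshold 4 N (1/32)` FOR EVERY `SU(N)`, `N ≥ 6`, HYPOTHESIS-FREE, BY THE DS ROUTE** — the cell's track-(a)
TARGET TYPE at the number of the sharp Bakry–Émery window (`1/48 < 1/32` and `MassGapBelow 4 N (1/32)`), obtained WITHOUT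
the global Hessian / Poisson machinery: star windows + the one-link eigen modulus.  A method-independent second leg for the
all-`N` `1/32` row when `N ≥ 6` (the Bakry–Émery capstone covers every `N ≥ 2`, `d ≥ 3`). [folklore] -/
theorem improvedThreshold_SU_eigen (hN : 6 ≤ N) : ImprovedThreshold 4 N (1 / 32) :=
  ⟨by norm_num, massGapBelow_SU_eigen hN⟩

/-- **`MassGapAt 4 N x` for every `N ≥ 10` at every `|x| ≤ 4/127 = 0.03149…`** (beyond `1/32 = 0.03125`), hypothesis-free,
by the DS route with the eigen modulus. [folklore] -/
theorem massGapAt_SU_eigen_ten (hN : 10 ≤ N) {x : ℝ} (h : |x| ≤ 4 / 127) : MassGapAt 4 N x := by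
  have hx0 : 0 ≤ |x| := abs_nonneg x
  have hR : |x| * 6 < 1 / 2 := by linarith
  have hN2 : 2 ≤ N := by omega
  have hK0 : 0 ≤ (N : ℝ) ^ 2 / ((N : ℝ) ^ 2 - 1) * ((1 / 2 + 2 * (|x| * 6)) / (1 / 2 - |x| * 6)) := by
    have h6 : (10 : ℝ) ≤ N := by exact_mod_cast hN
    exact mul_nonneg (div_nonneg (by positivity) (by nlinarith)) (div_nonneg (by linarith) (by linarith))
  refine star_massGapAt_of_oneLinkKRModulus (by omega) hK0 le_rfl (oneLinkKRModulus_eigen hN2 hR) ?_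
  have := door_le_ten hN hx0 h
  calc 4 * ((N : ℝ) ^ 2 / ((N : ℝ) ^ 2 - 1) * ((1 / 2 + 2 * (|x| * 6)) / (1 / 2 - |x| * 6)) * |x|)
      = 4 * ((N : ℝ) ^ 2 / ((N : ℝ) ^ 2 - 1) * ((1 / 2 + 2 * (6 * |x|)) / (1 / 2 - 6 * |x|)) * |x|) := by ring_nf
    _ ≤ 9 / 25 := this

/-- **`ImprovedThreshold 4 N (4/127)` for every `N ≥ 10`, hypothesis-free** — strictly beyond the sharp Bakry–Émery
window: `1/48 < 1/32 < 4/127` and `MassGapBelow 4 N (4/127)`.  The first all-large-`N` row of the cell beyond `1/32`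
(by `0.8 %`: a sentence, not a headline). [folklore] -/
theorem improvedThreshold_SU_eigen_ten (hN : 10 ≤ N) : ImprovedThreshold 4 N (4 / 127) :=
  ⟨by norm_num, fun _ hx => massGapAt_SU_eigen_ten hN hx.le⟩

/-- The numbers: `1/48 < 9/308 < 1/32 < 4/127` (printed Shen–Zhu–Zhu · star door with the Bakry–Émery modulus, every
`N ≥ 2` · sharp Bakry–Émery = eigen modulus for `N ≥ 6` · eigen modulus for `N ≥ 10`). [folklore] -/
theorem threshold_numbers_eigen :
    (1 : ℝ) / 48 < 9 / 308 ∧ (9 : ℝ) / 308 < 1 / 32 ∧ (1 : ℝ) / 32 < 4 / 127 := by norm_num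

end Summit.Ventures.YMGap.OneLinkEigenRows
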